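import Summits.ResolutionOfSingularities.ResolutionOfSingularities.Theses.UniformComplexity
import Summits.ResolutionOfSingularities.ResolutionOfSingularities.Theorems.UniformComplexityPrimeModelTransferAlgClosedTower
import HarnessLib

/-!
# Crux `PrimeModelTransfer` (stmt-ResolutionOfSingularities-8933) from the kernel at
# ALGEBRAICALLY CLOSED constant fields — and from finite transcendence degree

Route `ResolutionOfSingularities/UniformComplexity`, crux `PrimeModelTransfer` (stmt-8933): for a
prime `p`, resolution of integral separated finite-type schemes over the algebraically closed fields
algebraic over `𝔽_p` implies the same over every algebraically closed field of characteristic `p`.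

The landed glue `Theorems.PrimeModelTransfer.primeModelTransfer_of_climbRatFuncPerf` (p461439,
kill test K8.2) derives the crux from the shared open kernel `stub_climbRatFuncPerf` of
`Cruxes/PrimeModelTransfer/Lines/shared_climb_kernel.lean` = `Cruxes/PrimeFieldToPerfect/Lines/birth.lean`
("`M` PERFECT of characteristic `p` with resolution of all integral separated finite-type
`M`-schemes ⇒ resolution over every perfect field purely inseparable over `RatFunc M`").

**This file: two reductions of the crux that are specific to door 2 (algebraically closed targets).**

* `primeModelTransfer_of_climbAlgClosed` — TRDEG INDUCTION (the route header's foreseen split (a)):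
  the crux follows from the kernel RESTRICTED TO ALGEBRAICALLY CLOSED `M` of characteristic `p`.
  Given an algebraically closed `K`, every finite `S ⊆ K` lies in an algebraically closed subfield
  `A(S)` with resolution (`exists_isAlgClosed_subfield_hasResolution`: `A(∅) = 𝔽_p^{alg} ∩ K` by the
  crux hypothesis, `A(S ∪ {t}) = (A(S)(t))^{alg} ∩ K` by one kernel instance at the algebraically
  closed `A(S)` and the landed algebraic climb), and resolution descends from the perfect `A(S)` to
  `K` by spreading out and smooth base change (`hasResolution_of_perfectSubfields`). So door 2 of the
  W8.2 lever needs the shared kernel only for algebraically closed constant fields (of finite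
  transcendence degree over `𝔽_p`) — strictly inside the registered kernel, which
  `climbAlgClosed_of_climbRatFuncPerf` records.
* `primeModelTransfer_of_algebraicClosure_fg` — LIMIT STEP (the route header's split (c)): the crux
  follows from its restriction to the algebraically closed fields of FINITE TRANSCENDENCE DEGREE,
  presented as the relative algebraic closures `(closure s)^{alg} ∩ K` of finitely generated
  subfields of algebraically closed `K` (same descent lemma; no kernel involved).

Neither theorem proves the kernel; both are sorry-free reductions (`--supports` stmt-8933). What
remains open for door 2 is exactly: for `M` ALGEBRAICALLY CLOSED of characteristic `p` (of finite
transcendence degree over `𝔽_p`) with resolution in all dimensions, resolution over `M(t)^{perf}`.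
The catalogued transport barriers bound it as before (the fibre form "restrict a resolution of the
total space to the generic fibre and base-change along `M(t) ⊂ M(t)^{perf}`" is dead:
`Literature.Barriers.ResolutionOfSingularities.InseparableBaseChangeResolution.not_isRegular_stable_groundFieldExtension`,
`…RegularNotGeometricallyRegular` (Kollár 2007, 1.19), `…FrobeniusTwistResolution`); the family
form — regular total space over `M` — is what the hypothesis supplies at every level.

[OURS · LADDER-RESOLUTION L1, slot W8.2 (prime-field / universality transfer), door 2
UniformComplexity] Reductions over the summit's own route; they are NOT statements of, and attribute
nothing to, Hironaka's 2017 manuscript.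

Sources: Q. Liu, *Algebraic Geometry and Arithmetic Curves* (2002), Prop. 3.2.7, Cor. 4.3.33;
EGA IV₃ Thm. 8.8.2 (ii); Stacks Project 09GI. [cite: Liu2002, Prop. 3.2.7 and Cor. 4.3.33]
-/

noncomputable section

set_option linter.dupNamespace false -- mandated namespace of this single-conjunct summit

open CategoryTheory CategoryTheory.Limits AlgebraicGeometry TopologicalSpace
open Literature.AlgebraicGeometry.Resolution

namespace Summit.ResolutionOfSingularities.ResolutionOfSingularities.Theorems.PrimeModelTransfer

/-- **`PrimeModelTransfer` from the kernel at ALGEBRAICALLY CLOSED constant fields** (trdeg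
induction). If, for every prime `p` and every algebraically closed `M` of characteristic `p` over
which all integral separated schemes of finite type are resolvable, all integral separated schemes
of finite type over every perfect field purely inseparable over `RatFunc M` are resolvable, then
`UniformComplexity.PrimeModelTransfer` holds: for an algebraically closed `K` of characteristic `p`,
every finite `S ⊆ K` lies in an algebraically closed subfield with resolution
(`exists_isAlgClosed_subfield_hasResolution`), and resolution descends from these perfect subfields
to `K` (`hasResolution_of_perfectSubfields`). [folklore] -/
theorem primeModelTransfer_of_climbAlgClosed
    (hker : ∀ p : ℕ, p.Prime → ∀ (M : Type) [Field M] [CharP M p] [IsAlgClosed M],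
      (∀ (X : Scheme.{0}) (f : X ⟶ Spec (.of M)), IsSeparated f → LocallyOfFiniteType f →
        QuasiCompact f → IsIntegral X → Scheme.HasResolution X) →
      ∀ (L : Type) [Field L] [PerfectField L] [Algebra (RatFunc M) L]
        [IsPurelyInseparable (RatFunc M) L]
        (X : Scheme.{0}) (f : X ⟶ Spec (.of L)), IsSeparated f → LocallyOfFiniteType f →
          QuasiCompact f → IsIntegral X → Scheme.HasResolution X) :
    Summit.ResolutionOfSingularities.ResolutionOfSingularities.Theses.UniformComplexity.PrimeModelTransfer := by
  intro p hp hA K _ _ _ X f hs hl hq hX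
  haveI : Fact p.Prime := ⟨hp⟩
  haveI : PerfectField K := IsAlgClosed.perfectField K
  refine hasResolution_of_perfectSubfields K (fun s => ?_) X f hs hl hq hX
  obtain ⟨A, hsA, hAc, hAres⟩ :=
    exists_isAlgClosed_subfield_hasResolution p K (fun k _ _ _ hk => hA k hk) (hker p hp) s
  haveI : IsAlgClosed A := hAc
  exact ⟨A, hsA, IsAlgClosed.perfectField A, hAres⟩

/-- **The restricted kernel is implied by the registered one** (an algebraically closed field is
perfect): `primeModelTransfer_of_climbAlgClosed` refines the landed
`primeModelTransfer_of_climbRatFuncPerf` (p461439). [folklore] -/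
theorem climbAlgClosed_of_climbRatFuncPerf
    (hR : ∀ p : ℕ, p.Prime → ∀ (M : Type) [Field M] [CharP M p] [PerfectField M],
      (∀ (X : Scheme.{0}) (f : X ⟶ Spec (.of M)), IsSeparated f → LocallyOfFiniteType f →
        QuasiCompact f → IsIntegral X → Scheme.HasResolution X) →
      ∀ (L : Type) [Field L] [PerfectField L] [Algebra (RatFunc M) L]
        [IsPurelyInseparable (RatFunc M) L]
        (X : Scheme.{0}) (f : X ⟶ Spec (.of L)), IsSeparated f → LocallyOfFiniteType f →
          QuasiCompact f → IsIntegral X → Scheme.HasResolution X) :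
    ∀ p : ℕ, p.Prime → ∀ (M : Type) [Field M] [CharP M p] [IsAlgClosed M],
      (∀ (X : Scheme.{0}) (f : X ⟶ Spec (.of M)), IsSeparated f → LocallyOfFiniteType f →
        QuasiCompact f → IsIntegral X → Scheme.HasResolution X) →
      ∀ (L : Type) [Field L] [PerfectField L] [Algebra (RatFunc M) L]
        [IsPurelyInseparable (RatFunc M) L]
        (X : Scheme.{0}) (f : X ⟶ Spec (.of L)), IsSeparated f → LocallyOfFiniteType f →
          QuasiCompact f → IsIntegral X → Scheme.HasResolution X := by
  intro p hp M _ _ _ hM L _ _ _ _ X f hs hl hq hX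
  haveI : PerfectField M := IsAlgClosed.perfectField M
  exact hR p hp M hM L X f hs hl hq hX

/-- **`PrimeModelTransfer` from finite transcendence degree** (limit step). If, for every prime
`p`, the crux hypothesis (resolution over algebraically closed fields of characteristic `p`
algebraic over `𝔽_p`) gives resolution of all integral separated schemes of finite type over the
relative algebraic closure `(closure s)^{alg} ∩ K` of every finitely generated subfield
`closure s` of every algebraically closed `K` of characteristic `p` — these are exactly the
algebraically closed fields of finite transcendence degree over `𝔽_p`, embedded in `K` — then
`UniformComplexity.PrimeModelTransfer` holds (descent from these perfect subfields,
`hasResolution_of_perfectSubfields`). [folklore] -/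
theorem primeModelTransfer_of_algebraicClosure_fg
    (hfin : ∀ p : ℕ, p.Prime →
      (∀ (k : Type) [Field k] [CharP k p] [IsAlgClosed k],
        (∀ x : k, ∃ n : ℕ, 0 < n ∧ x ^ p ^ n = x) →
        ∀ (X : Scheme.{0}) (f : X ⟶ Spec (.of k)), IsSeparated f → LocallyOfFiniteType f →
          QuasiCompact f → IsIntegral X → Scheme.HasResolution X) →
      ∀ (K : Type) [Field K] [CharP K p] [IsAlgClosed K] (s : Finset K)
        (X : Scheme.{0})
        (f : X ⟶ Spec (.of (algebraicClosure (Subfield.closure (↑s : Set K)) K))),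
        IsSeparated f → LocallyOfFiniteType f → QuasiCompact f → IsIntegral X →
          Scheme.HasResolution X) :
    Summit.ResolutionOfSingularities.ResolutionOfSingularities.Theses.UniformComplexity.PrimeModelTransfer := by
  intro p hp hA K _ _ _ X f hs hl hq hX
  haveI : Fact p.Prime := ⟨hp⟩
  haveI : PerfectField K := IsAlgClosed.perfectField K
  refine hasResolution_of_perfectSubfields K (fun s => ?_) X f hs hl hq hX
  let F : Subfield K := Subfield.closure (↑s : Set K)
  let L : IntermediateField F K := algebraicClosure F K
  haveI : IsAlgClosed L := IsAlgClosure.isAlgClosed F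
  refine ⟨L.toSubfield, fun x hx => ?_, inferInstanceAs (PerfectField L), ?_⟩
  · exact L.algebraMap_mem (⟨x, Subfield.subset_closure hx⟩ : F)
  · haveI : PerfectField L := IsAlgClosed.perfectField L
    exact fun Y g hs' hl' hq' hY => hfin p hp (fun k _ _ _ hk => hA k hk) K s Y g hs' hl' hq' hY

end Summit.ResolutionOfSingularities.ResolutionOfSingularities.Theorems.PrimeModelTransfer

end
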